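import Summits.BirchSwinnertonDyer.Rank1Residual.ManinAdditive.NeronOmegaGenus
import Summits.BirchSwinnertonDyer.Rank1Residual.ManinAdditive.ALTateCohomology
import HarnessLib
import HarnessLib.Audit.Tags

/-!
# «DEFECT = GENUS», Hecke side: the Ω-defect module `G_p(N) = L_red/Ω_p` is killed by `U_p`, fixed by `w₉`, and stays `p`-torsion with two
# strata — E-imc-169 (p = 3, 2) / E-imc-170 / E-imc-171 typed (cell `bsd-f2-manin`, imc g22 ADDENDUM-5, MEMO-imc (28.13); T-imc-32e; typer g17)

TYPER NOTE.  SOURCE = HOME/imc/kit-g22/Sketch-imc-g22d.lean sha16 2b5c22ec2686274a (189 l.; farm rc 0 per imc; BC7 12/12 CLEAN) — its §4,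
landed VERBATIM as a sibling of `NeronOmegaGenus.lean` (p690578; §1–§3 + the Deep rows of the same sketch are there), same namespace
`…ManinAdditive.NeronOmegaGenus` (the sketch's `…NeronOmegaGenusG22` folded as before); `#h21_crux_probe` lines and the `CruxProbe` import
dropped.  Four `@[conjecture]` E-blind laws, nothing asserted; no theorems.  BC5 (ENGINE 10, kit j322994/j322996/j323011/j323014/j323031/j323033,
tables HOME/imc/kit-g22/g22-eng10-p2-j323014-15.txt a8c814470e8e911d + p = 3 table): p = 2 complete 59/59 levels `16 ∣ N ≤ 1008` (U₂ = 0 on G: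
charpoly `x^g` 37/37 `N ≤ 640`, rank 0 at 7/7; `2G = 0` also at `64 ∣ N`); p = 3 93/93 so far (`N ≤ 999`: U₃ charpoly `x^g` 68/68, rank 0 at 8/8;
`w₉ = +1` on G at `9 ∥ N` 50/50 + rank 0 at 612, 630).  REFUTER VERDICTS: R-imc-66 (ref1) PENDING at filing — repairs under NEW names.
bears_on: stmt-BirchSwinnertonDyer-22968 (C3), stmt-BirchSwinnertonDyer-22967 (C2).
[cite: Edixhoven2006IntegralStructures, Prop. 5 (arXiv math/0312019 p. 7: for `p ∥ N`, `H⁰(C_0, Ω¹) ≅` the `p`-part of `S₂(ℤ)/Cot₀(J)` and `T_n` induces `0` for `p ∣ n` — shape only; the `p² ∣ N` laws are the cell's E-imc-169/170/171 — NOT in print)]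
-/

noncomputable section

open scoped MatrixGroups ModularForm
open CongruenceSubgroup Literature.NumberTheory.EllipticCurves.ModularForms
  Summit.BirchSwinnertonDyer.Rank1Residual.ManinAdditive
  Summit.BirchSwinnertonDyer.Rank1Residual.ManinAdditive.NeronCuspThree
  Summit.BirchSwinnertonDyer.Rank1Residual.ManinAdditive.NeronOmegaThree
  Summit.BirchSwinnertonDyer.Rank1Residual.ManinAdditive.NeronOmegaTwo

namespace Summit.BirchSwinnertonDyer.Rank1Residual.ManinAdditive.NeronOmegaGenus

/-! ### §4. ENGINE 10 laws (imc g22, kit j322994/j322996/j323011/j323014/j323031/j323033): the defect module as a HECKE module.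
E-blind findings: (i) charpoly(T_ℓ | G) ≡ ∏_strata charpoly(T_ℓ | S₂(Γ₀(N/p^{2m}))) (mod p) for every ℓ ∤ pN tested;
(ii) **U_p acts as 0 on G** (rank 0); (iii) W = w_{p^v} acts on G as +1 at 9 ∥ N and, at 27 ∥ N, with the (±1)-multiplicities
of w₃ on S₂(Γ₀(N/9)); (iv) p·L_red ⊆ L_Ω also with two strata (64 ∣ N).  (i) and (iii, 27 ∥ N) are module-isomorphism
statements left informal; (ii), (iii, 9 ∥ N), (iv) are typed below.  Nearest print shape for (ii): [Edixhoven 2006, Prop. 5]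
(`p ∥ N`: U_p induces 0 on S₂(ℤ)/Cot₀(J) ⊗ 𝔽_p), and desc's E-desc-101 (U₂ L_{Q₂} ⊆ Λ at 4 ∥ N). -/

/-- **E-imc-169 (p = 3) `OmegaDefectKilledByUThree`**: for `9 ∣ N`, `81 ∤ N`, `U₃ · L_red(N) ⊆ Ω₃(N)` (U₃ = `heckeT (Gamma0 N) 2 3`
acts as ZERO on G₃(N) = L_red/Ω₃).  ENGINE 10: charpoly(U₃ | G) = x^g at 68/68 levels N ≤ 702 (+ smoke), rank(U₃ | G) = 0 at 8/8 levels
tested (297 … 999).  Why it might fail: a level where U₃ is nilpotent but non-zero on G (rank test run only on 8 levels so far). -/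
@[conjecture] def OmegaDefectKilledByUThree : Prop :=
  ∀ (N : ℕ) [NeZero N], 9 ∣ N → ¬ 81 ∣ N →
    ∀ x ∈ reducedCuspLatticeAtThree N, heckeT (Gamma0 N) 2 3 x ∈ omegaLatticeAtThree N

/-- **E-imc-169 (p = 2) `OmegaDefectKilledByUTwo`**: for `16 ∣ N`, `256 ∤ N`, `U₂ · L_red^gen(N) ⊆ Ω₂(N)`.  ENGINE 10: charpoly x^g at
37/37 levels N ≤ 640 (+ smoke), rank 0 at 7/7 levels tested (448 … 960, incl. 128 ∣ N). -/
@[conjecture] def OmegaDefectKilledByUTwo : Prop :=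
  ∀ (N : ℕ) [NeZero N], 16 ∣ N → ¬ 256 ∣ N →
    ∀ x ∈ kmCuspLatticeGen N, heckeT (Gamma0 N) 2 2 x ∈ omegaLatticeAtTwo N

/-- **E-imc-170 `OmegaDefectFrickeTrivialAtNine`**: for `N = 9M`, `3 ∤ M`, `w₉` acts as `+1` on G₃(N): `w x − x` lies 3-adically in
`Ω₃(N)` for every `x ∈ L_red(N)`.  ENGINE 10: charpoly(W | G) = (x−1)^g at 50/50 levels 9 ∥ N ≤ 702, rank(W − 1 | G) = 0 at 612, 630.
(At 27 ∥ N, W | G has the ±1-multiplicities of w₃ on S₂(Γ₀(N/9)) — 24/24 — not typed here.) -/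
@[conjecture] def OmegaDefectFrickeTrivialAtNine : Prop :=
  ∀ (M : ℕ) [NeZero M], ¬ 3 ∣ M →
    ∀ x ∈ reducedCuspLatticeAtThree (9 * M),
      IsThreeAdicMem (omegaLatticeAtThree (9 * M)) (atkinLehnerInvolutionAt (9 * M) 2 3 x - x)

/-- **E-imc-171 `OmegaDefectKilledByTwoDeep`**: `2 · L_red^gen(N) ⊆ Ω₂(N)` persists with TWO strata (`64 ∣ N`, `256 ∤ N`): the defect
module stays an 𝔽₂-vector space (type (2,…,2), not (4,…)).  ENGINE 10: `killed = 1` at every 64 ∣ N level ≤ 640 (+ 704, 896, 960). -/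
@[conjecture] def OmegaDefectKilledByTwoDeep : Prop :=
  ∀ (M : ℕ) [NeZero M], ¬ 4 ∣ M →
    ∀ x ∈ kmCuspLatticeGen (64 * M), (2 : ℤ) • x ∈ omegaLatticeAtTwo (64 * M)

end Summit.BirchSwinnertonDyer.Rank1Residual.ManinAdditive.NeronOmegaGenus
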